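/-
Copyright (c) 2026. All rights reserved.
Released under Apache 2.0 license as described in the file LICENSE.
-/
import Literature.NumberTheory.Weil1964.AdelicSchrodingerConjCont
import Literature.NumberTheory.Weil1964.AdelicMetaplecticFinRep
import HarnessLib

/-!
# Complex conjugation of the finite factor: `ω_f^{−T}(sᶜ) = C ω_f^{T}(s) C`

Topic `NumberTheory/Weil1964`; namespace `Literature.NumberTheory.Weil1964`.  KERNEL MATHEMATICS ONLY: definitions +
theorems over tree declarations; no `def … : Prop` record of a published theorem, no `axiom`, no proof hole.

SETTING.  `AdelicSchrodingerConjCont.lean` proves, on the metaplectic group OF RECORD `Mp_ψ(W_T)ᶜᵒⁿᵗ = adelicMpCont F ι T`,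
that the Weil representation of the space with the NEGATED form is the complex conjugate of the Weil representation:
`adelicMpContConj F ι T : Mp_ψ(W_T)ᶜᵒⁿᵗ ≃* Mp_ψ(W_{−T})ᶜᵒⁿᵗ`, `(g, M) ↦ (g, C M C)`, covering the identity of `Sp(W_𝔸)`,
with `ω_{−T}(pᶜ) Ψ = C (ω_T(p) (C Ψ))` ([Li1992, p. 181]: «`ω*` … is the same as `ω_{ψ̄}`»; [MVW87, Chap. 2 II.1]).
`AdelicMetaplecticFinRep.lean` reads off, for a homomorphism `s : H →* Mp_ψ(W_T)ᶜᵒⁿᵗ` whose symplectic components fix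
the archimedean vectors, the FINITE FACTOR `finRepMp s : H → End 𝒮((𝔸_F^∞)^ι)` with `ω(s h) = 1 ⊗ finRepMp s h`
([Weil1964, Chap. III n° 37–38]).

WHAT IS HERE (all proved, [folklore] bookkeeping on the two files above):
* §1 complex conjugation `C_f : Φ_f ↦ Φ̄_f` of `𝒮((𝔸_F^∞)^ι) = FinSB` as a CONJUGATE-LINEAR involution
  (`finSBConjₛₗ : FinSB ≃ₛₗ[conj] FinSB`), the `ℂ`-linear sandwich `C_f B C_f` of a `ℂ`-linear `B` (`finSBConjConj`), and
  the conjugate `ρᶜ : h ↦ C_f ρ(h) C_f` of a representation on `FinSB` (`Representation.finSBConj`), again a representation.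
* §2 the conjugate `sᶜ := (·)ᶜ ∘ s : H →* Mp_ψ(W_{−T})ᶜᵒⁿᵗ` of a homomorphism `s : H →* Mp_ψ(W_T)ᶜᵒⁿᵗ` (`splittingConj`); its
  symplectic components are those of `s` (`coe_proj_splittingConj`), so it fixes the archimedean vectors when `s` does.
* §3 **THE FINITE FACTOR OF THE CONJUGATE MODEL IS THE CONJUGATE OF THE FINITE FACTOR**:
  `finRepMp (−T) sᶜ h = C_f (finRepMp T s h) C_f` (`finRepMp_splittingConj`, from the uniqueness of the finite factor and
  `C(φ ⊗ Φ_f) = φ̄ ⊗ Φ̄_f`), i.e. `C_f` is a conjugate-linear `H`-intertwiner `ω_f^{T}∘s → ω_f^{−T}∘sᶜ`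
  (`finSBConj_finRepMp`), and `finRepMp (−T) sᶜ = (finRepMp T s)ᶜ` as representations (`finRepMp_splittingConj_eq`).

USE (pub-hodgecm, Track T (T4) of the re-key plan): the block's Weil module `(line i).Ω ιV χ` is the `χ`-coinvariant
quotient of `finRepMp` along the dual-pair splitting of the line; §3 is the operator law (T4b) at the level of the finite
Weil representation — the line with the negated form `−⟨·,·⟩_W` (Gram class `−a`) carries the conjugate finite Weil
representation along the conjugate splitting.  Nothing here concerns coinvariants, characters or CM types.

## References
* [Li1992] J.-S. Li, *Non-vanishing theorems for the cohomology of certain arithmetic quotients*, J. reine angew. Math.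
  428 (1992) 177–217, p. 181.
* [MoeglinVignerasWaldspurger1987] C. Mœglin, M.-F. Vignéras, J.-L. Waldspurger, *Correspondances de Howe sur un corps
  p-adique*, LNM 1291 (1987), Chap. 2 II.1.
* [Weil1964] A. Weil, *Sur certains groupes d'opérateurs unitaires*, Acta Math. 111 (1964), Chap. III n° 37–38 pp. 188–190.
-/

set_option autoImplicit false

noncomputable section

open scoped TensorProduct ComplexConjugate Classical

namespace Literature.NumberTheory.Weil1964

open Literature.RepresentationTheory.HeisenbergGroup Literature.NumberTheory.Automorphic NumberField
  NumberField.mixedEmbedding IsDedekindDomain TensorProduct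

/-! ## §1 Complex conjugation on `𝒮((𝔸_F^∞)^ι)` as a conjugate-linear involution -/

section FinSB

variable {K : Type} [Field K] [NumberField K] {ι : Type}

/-- `C_f (C_f Φ) = Φ`: complex conjugation of `𝒮(X_f)` is an involution. [cite: MoeglinVignerasWaldspurger1987, Chap. 2 II.1 (transport of structure along complex conjugation; part)] -/
@[simp] theorem finSBConj_finSBConj (Φ : FinSB K ι) : finSBConj (finSBConj Φ) = Φ :=
  Subtype.ext (star_star (Φ : (ι → FiniteAdeleRing (𝓞 K) K) → ℂ))

/-- `C_f (Φ + Ψ) = C_f Φ + C_f Ψ`: complex conjugation of `𝒮(X_f)` is additive. [cite: MoeglinVignerasWaldspurger1987, Chap. 2 II.1 (transport of structure along complex conjugation; part)] -/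
theorem finSBConj_add (Φ Ψ : FinSB K ι) : finSBConj (Φ + Ψ) = finSBConj Φ + finSBConj Ψ :=
  Subtype.ext (star_add (Φ : (ι → FiniteAdeleRing (𝓞 K) K) → ℂ) (Ψ : (ι → FiniteAdeleRing (𝓞 K) K) → ℂ))

/-- `C_f (c • Φ) = c̄ • C_f Φ`: complex conjugation of `𝒮(X_f)` is conjugate-linear. [cite: MoeglinVignerasWaldspurger1987, Chap. 2 II.1 (transport of structure along complex conjugation; part)] -/
theorem finSBConj_smul (c : ℂ) (Φ : FinSB K ι) : finSBConj (c • Φ) = conj c • finSBConj Φ :=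
  Subtype.ext (star_smul c (Φ : (ι → FiniteAdeleRing (𝓞 K) K) → ℂ))

/-- `C_f 0 = 0`. [cite: MoeglinVignerasWaldspurger1987, Chap. 2 II.1 (transport of structure along complex conjugation; part)] -/
@[simp] theorem finSBConj_zero : finSBConj (0 : FinSB K ι) = 0 :=
  Subtype.ext (star_zero ((ι → FiniteAdeleRing (𝓞 K) K) → ℂ))

/-- **`C_f : 𝒮((𝔸_K^∞)^ι) ≃ₛₗ[conj] 𝒮((𝔸_K^∞)^ι)`**, `Φ_f ↦ Φ̄_f`, a conjugate-linear involution. [folklore] -/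
def finSBConjₛₗ : FinSB K ι ≃ₛₗ[starRingEnd ℂ] FinSB K ι where
  toFun := finSBConj
  invFun := finSBConj
  map_add' := finSBConj_add
  map_smul' := finSBConj_smul
  left_inv := finSBConj_finSBConj
  right_inv := finSBConj_finSBConj

/-- unfolding: the conjugate-linear involution is `Φ_f ↦ Φ̄_f`. [cite: MoeglinVignerasWaldspurger1987, Chap. 2 II.1 (transport of structure along complex conjugation; part)] -/
@[simp] theorem finSBConjₛₗ_apply (Φ : FinSB K ι) : finSBConjₛₗ Φ = finSBConj Φ := rfl

/-- `C_f⁻¹ = C_f`. [cite: MoeglinVignerasWaldspurger1987, Chap. 2 II.1 (transport of structure along complex conjugation; part)] -/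
@[simp] theorem finSBConjₛₗ_symm : (finSBConjₛₗ : FinSB K ι ≃ₛₗ[starRingEnd ℂ] FinSB K ι).symm = finSBConjₛₗ := rfl

/-- the sandwich `C_f B C_f` of a `ℂ`-linear endomorphism `B` of `𝒮((𝔸_K^∞)^ι)`: `ℂ`-linear again. [folklore] -/
def finSBConjConj (B : FinSB K ι →ₗ[ℂ] FinSB K ι) : FinSB K ι →ₗ[ℂ] FinSB K ι where
  toFun Φ := finSBConj (B (finSBConj Φ))
  map_add' Φ Ψ := by
    rw [finSBConj_add, map_add, finSBConj_add]
  map_smul' c Φ := by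
    rw [finSBConj_smul, map_smul, finSBConj_smul, Complex.conj_conj, RingHom.id_apply]

/-- pointwise formula of the sandwich `C_f B C_f`. [cite: MoeglinVignerasWaldspurger1987, Chap. 2 II.1 (transport of structure along complex conjugation; part)] -/
@[simp] theorem finSBConjConj_apply (B : FinSB K ι →ₗ[ℂ] FinSB K ι) (Φ : FinSB K ι) :
    finSBConjConj B Φ = finSBConj (B (finSBConj Φ)) :=
  rfl

/-- `C_f 1 C_f = 1`: the sandwich is unital. [cite: MoeglinVignerasWaldspurger1987, Chap. 2 II.1 (transport of structure along complex conjugation; part)] -/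
@[simp] theorem finSBConjConj_one : finSBConjConj (1 : FinSB K ι →ₗ[ℂ] FinSB K ι) = 1 :=
  LinearMap.ext fun Φ => by rw [finSBConjConj_apply, Module.End.one_apply, Module.End.one_apply, finSBConj_finSBConj]

/-- `C_f (A B) C_f = (C_f A C_f) (C_f B C_f)`: the sandwich is multiplicative. [cite: MoeglinVignerasWaldspurger1987, Chap. 2 II.1 (transport of structure along complex conjugation; part)] -/
theorem finSBConjConj_mul (A B : FinSB K ι →ₗ[ℂ] FinSB K ι) :
    finSBConjConj (A * B) = finSBConjConj A * finSBConjConj B :=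
  LinearMap.ext fun Φ => by
    rw [finSBConjConj_apply, Module.End.mul_apply, Module.End.mul_apply, finSBConjConj_apply, finSBConjConj_apply,
      finSBConj_finSBConj]

/-- `C_f (C_f B C_f) C_f = B`: the sandwich is an involution. [cite: MoeglinVignerasWaldspurger1987, Chap. 2 II.1 (transport of structure along complex conjugation; part)] -/
@[simp] theorem finSBConjConj_finSBConjConj (B : FinSB K ι →ₗ[ℂ] FinSB K ι) :
    finSBConjConj (finSBConjConj B) = B :=
  LinearMap.ext fun Φ => by rw [finSBConjConj_apply, finSBConjConj_apply, finSBConj_finSBConj, finSBConj_finSBConj]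

variable {H : Type*} [Monoid H]

/-- **the conjugate representation** `ρᶜ : h ↦ C_f ρ(h) C_f` of a representation `ρ` of a monoid on `𝒮((𝔸_K^∞)^ι)`.
[folklore] -/
def _root_.Representation.finSBConj (ρ : Representation ℂ H (FinSB K ι)) : Representation ℂ H (FinSB K ι) where
  toFun h := finSBConjConj (ρ h)
  map_one' := by rw [map_one, finSBConjConj_one]
  map_mul' h h' := by rw [map_mul, finSBConjConj_mul]

/-- unfolding: `ρᶜ h Φ = C_f (ρ h (C_f Φ))`. [cite: MoeglinVignerasWaldspurger1987, Chap. 2 II.1 (transport of structure along complex conjugation; part)] -/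
@[simp] theorem _root_.Representation.finSBConj_apply (ρ : Representation ℂ H (FinSB K ι)) (h : H) (Φ : FinSB K ι) :
    ρ.finSBConj h Φ = finSBConj (ρ h (finSBConj Φ)) :=
  rfl

/-- `C_f` intertwines `ρ` and `ρᶜ` (conjugate-linearly): `C_f (ρ h Φ) = ρᶜ h (C_f Φ)`. [cite: MoeglinVignerasWaldspurger1987, Chap. 2 II.1 (transport of structure along complex conjugation; part)] -/
theorem _root_.Representation.finSBConj_intertwine (ρ : Representation ℂ H (FinSB K ι)) (h : H) (Φ : FinSB K ι) :
    finSBConj (ρ h Φ) = ρ.finSBConj h (finSBConj Φ) := by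
  rw [Representation.finSBConj_apply, finSBConj_finSBConj]

/-- `(ρᶜ)ᶜ = ρ`. [cite: MoeglinVignerasWaldspurger1987, Chap. 2 II.1 (transport of structure along complex conjugation; part)] -/
@[simp] theorem _root_.Representation.finSBConj_finSBConj (ρ : Representation ℂ H (FinSB K ι)) :
    ρ.finSBConj.finSBConj = ρ :=
  MonoidHom.ext fun h => by
    change finSBConjConj (finSBConjConj (ρ h)) = ρ h
    rw [finSBConjConj_finSBConjConj]

end FinSB

/-! ## §2 The conjugate of a homomorphism into the metaplectic group of record -/

section Splitting

variable {F : Type} [Field F] [NumberField F] {ι : Type} [Fintype ι] [DecidableEq ι]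
  {T : Matrix ι ι (AdeleRing (𝓞 F) F)} {H : Type*} [Monoid H]

/-- **`sᶜ : H →* Mp_ψ(W_{−T})ᶜᵒⁿᵗ`**, `h ↦ (s h)ᶜ = (π(s h), C ω(s h) C)`, the conjugate of a homomorphism
`s : H →* Mp_ψ(W_T)ᶜᵒⁿᵗ`. [cite: MoeglinVignerasWaldspurger1987, Chap. 2 II.1] -/
def splittingConj (s : H →* adelicMpCont F ι T) : H →* adelicMpCont F ι (-T) :=
  (adelicMpContConj F ι T).toMonoidHom.comp s

/-- unfolding: `sᶜ h = (s h)ᶜ`. [cite: MoeglinVignerasWaldspurger1987, Chap. 2 II.1] -/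
@[simp] theorem splittingConj_apply (s : H →* adelicMpCont F ι T) (h : H) :
    splittingConj s h = adelicMpContConj F ι T (s h) :=
  rfl

/-- **`π(sᶜ h) = π(s h)` in `GL(W_𝔸)`**: the conjugate homomorphism has the same symplectic components.
[cite: MoeglinVignerasWaldspurger1987, Chap. 2 II.1 (B)] -/
theorem coe_proj_splittingConj (s : H →* adelicMpCont F ι T) (h : H) :
    ((adelicMpCont.proj F ι (-T) (splittingConj s h) : symplecticGroup (polar (adelicForm F ι (-T)))) :
        ((ι → AdeleRing (𝓞 F) F) × (ι → AdeleRing (𝓞 F) F)) ≃ₗ[AdeleRing (𝓞 F) F]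
          ((ι → AdeleRing (𝓞 F) F) × (ι → AdeleRing (𝓞 F) F))) =
      (adelicMpCont.proj F ι T (s h) : symplecticGroup (polar (adelicForm F ι T))) :=
  coe_proj_adelicMpContConj (s h)

/-- if the symplectic components of `s` fix the archimedean vectors, so do those of `sᶜ` (same components).
[cite: MoeglinVignerasWaldspurger1987, Chap. 2 II.1 (B)] -/
theorem archVec_fixed_splittingConj (s : H →* adelicMpCont F ι T)
    (harch : ∀ (h : H) (a w : ι → mixedSpace F),
      (adelicMpCont.proj F ι T (s h)).1 (archVec F ι a, archVec F ι w) = (archVec F ι a, archVec F ι w))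
    (h : H) (a w : ι → mixedSpace F) :
    (adelicMpCont.proj F ι (-T) (splittingConj s h)).1 (archVec F ι a, archVec F ι w) =
      (archVec F ι a, archVec F ι w) :=
  (congrArg (fun g : ((ι → AdeleRing (𝓞 F) F) × (ι → AdeleRing (𝓞 F) F)) ≃ₗ[AdeleRing (𝓞 F) F]
      ((ι → AdeleRing (𝓞 F) F) × (ι → AdeleRing (𝓞 F) F)) => g (archVec F ι a, archVec F ι w))
    (coe_proj_splittingConj s h)).trans (harch h a w)

end Splitting

/-! ## §3 The finite factor of the conjugate model -/

section FinRepMpConj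

variable {F : Type} [Field F] [NumberField F] {ι : Type} [Fintype ι] [DecidableEq ι]
  {T : Matrix ι ι (AdeleRing (𝓞 F) F)} {H : Type*} [Monoid H]

omit [DecidableEq ι] in
/-- the archimedean test function `φ₀` of `AdelicMetaplecticFinRep` is non-zero (`φ₀(0) = 1`). [folklore] -/
private theorem unitSchwartz_ne_zero : unitSchwartz F ι ≠ 0 := by
  intro h
  have h1 := unitSchwartz_apply_zero (F := F) (ι := ι)
  rw [h] at h1
  change (0 : ℂ) = 1 at h1
  exact zero_ne_one h1

variable (hT : IsUnit T) (s : H →* adelicMpCont F ι T)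
  (harch : ∀ (h : H) (a w : ι → mixedSpace F),
    (adelicMpCont.proj F ι T (s h)).1 (archVec F ι a, archVec F ι w) = (archVec F ι a, archVec F ι w))

/-- **`ω_{−T}(sᶜ h) (φ ⊗ Φ_f) = φ ⊗ C_f (finRepMp T s h (C_f Φ_f))`** on pure tensors.
[cite: Li1992, p. 181; Weil1964, Chap. III n° 37–38 pp. 188–190] -/
theorem omega_splittingConj_map_tmul (h : H) (φ : SchwartzMap (ι → mixedSpace F) ℂ) (f : FinSB F ι) :
    adelicMpCont.omega F ι (-T) (splittingConj s h) (piSchwartzBruhatEquiv F ι (φ ⊗ₜ f)) =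
      piSchwartzBruhatEquiv F ι (φ ⊗ₜ finSBConj (finRepMp hT s harch h (finSBConj f))) :=
  -- explicit `Eq.trans` chain: a `rw` would make `kabstract` compare the `T`- and `−T`-instances of the patterns
  -- (time-out in `isDefEq` on adelic negation, as noted in `AdelicSchrodingerConjCont`).
  (adelicMpCont.omega_adelicMpContConj_apply (s h) (piSchwartzBruhatEquiv F ι (φ ⊗ₜ f))).trans
    ((congrArg (fun Ψ => piSchwartzBruhatConj F ι (adelicMpCont.omega F ι T (s h) Ψ))
      (piSchwartzBruhatConj_equiv_tmul F ι φ f)).trans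
      ((congrArg (piSchwartzBruhatConj F ι)
        (omega_map_tmul_finRepMp hT s harch h (schwartzConj φ) (finSBConj f))).trans
        ((piSchwartzBruhatConj_equiv_tmul F ι (schwartzConj φ) (finRepMp hT s harch h (finSBConj f))).trans
          (congrArg (fun ψ => piSchwartzBruhatEquiv F ι (ψ ⊗ₜ finSBConj (finRepMp hT s harch h (finSBConj f))))
            (schwartzConj_schwartzConj φ)))))

/-- **THE FINITE FACTOR OF THE CONJUGATE MODEL**: `finRepMp (−T) sᶜ h = C_f (finRepMp T s h) C_f`.
[cite: Li1992, p. 181; Weil1964, Chap. III n° 37–38 pp. 188–190] -/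
theorem finRepMp_splittingConj (h : H) :
    finRepMp hT.neg (splittingConj s) (archVec_fixed_splittingConj s harch) h =
      finSBConjConj (finRepMp hT s harch h) :=
  (finRepMp_unique hT.neg (splittingConj s) (archVec_fixed_splittingConj s harch) h
    (unitSchwartz_ne_zero (F := F) (ι := ι)) (B := finSBConjConj (finRepMp hT s harch h))
    (fun f => (omega_splittingConj_map_tmul hT s harch h (unitSchwartz F ι) f).trans rfl)).symm

/-- pointwise: `finRepMp (−T) sᶜ h Φ_f = C_f (finRepMp T s h (C_f Φ_f))`. [cite: Weil1964, Chap. III n° 37–38 pp. 188–190; Li1992, p. 181] -/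
theorem finRepMp_splittingConj_apply (h : H) (f : FinSB F ι) :
    finRepMp hT.neg (splittingConj s) (archVec_fixed_splittingConj s harch) h f =
      finSBConj (finRepMp hT s harch h (finSBConj f)) := by
  rw [finRepMp_splittingConj hT s harch h, finSBConjConj_apply]

/-- **`C_f` is a conjugate-linear `H`-intertwiner `ω_f^{T} ∘ s → ω_f^{−T} ∘ sᶜ`**:
`C_f (finRepMp T s h Φ_f) = finRepMp (−T) sᶜ h (C_f Φ_f)`. [cite: Li1992, p. 181] -/
theorem finSBConj_finRepMp (h : H) (f : FinSB F ι) :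
    finSBConj (finRepMp hT s harch h f) =
      finRepMp hT.neg (splittingConj s) (archVec_fixed_splittingConj s harch) h (finSBConj f) := by
  rw [finRepMp_splittingConj_apply hT s harch, finSBConj_finSBConj]

/-- as representations: `finRepMp (−T) sᶜ = (finRepMp T s)ᶜ`. [cite: Li1992, p. 181] -/
theorem finRepMp_splittingConj_eq :
    finRepMp hT.neg (splittingConj s) (archVec_fixed_splittingConj s harch) = (finRepMp hT s harch).finSBConj :=
  MonoidHom.ext fun h => finRepMp_splittingConj hT s harch h

end FinRepMpConj

end Literature.NumberTheory.Weil1964
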